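import Mathlib.AlgebraicGeometry.EllipticCurve.Affine.Point
import Mathlib.Tactic.LinearCombination
import Mathlib.Tactic.FieldSimp
import HarnessLib

/-!
# Chord identities for a nonsingular point and a `2`-torsion point on a Weierstrass curve

Let `W` be a Weierstrass curve over a field `F`, `P = (x₁, y₁)` a point of `W` and `T = (e, t)` a
point with `2T = O`, i.e. `η(T) = 0` where **`η(x, y) := 2y + a₁x + a₃`** is the completed-square
ordinate (`η² = Ψ(x) := 4x³ + b₂x² + 2b₄x + b₆` on the curve, `η(−P) = −η(P)`).  Suppose `x₁ ≠ e`
and write `P + T = (x₃, y₃)` (Mathlib's chord formulas `addX`, `addY`, `slope`).  The three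
intersection points `T, P, −(P+T)` of `W` with the chord `y = λ(x − e) + t` are the roots of the cubic
`Ψ(x) − μ²(x − e)² = 4(x − e)(x − x₁)(x − x₃)` (`μ = 2λ + a₁`) and `η` restricted to the chord is the
linear function `μ(x − e)`.  Dividing by `x − e` and evaluating gives the two identities of this file:

* `four_mul_sub_mul_addX_sub` — **(T1)** `4 (x₁ − e)(x₃ − e) = Ψ′(e) = 12e² + 2b₂e + 2b₄`
  (the translation-by-a-`2`-torsion-point formula `x(P+T) − e = Ψ′(e)/(4(x(P) − e))`);
* `eta_add_mul_sub` — **(Y)** `η(P+T)·(x₁ − e) = −η(P)·(x₃ − e)`.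

Also: `eta_sq_eq` (`η² = Ψ(x)` on the curve), `eta_eq_zero_iff_add_self_eq_zero` (`η(T) = 0 ↔ 2T = O`
for a nonsingular affine point), `derivative_twoTorsionPolynomial_eval` (`Ψ′(e) = 12e² + 2b₂e + 2b₄`).
These are the geometric inputs of the explicit Kummer-isotropy computation for the level-`2`
Heisenberg (theta) group (cell `bsd-f1-sign2`, route `GenusKolyvaginAtTwo`; files
`HeisenbergGroupLevelTwo*.lean`): with `D_T := (x(P) − e)(x(P+T) − e) = Ψ′(e)/4` independent of `P`.

References: J. H. Silverman, *The Arithmetic of Elliptic Curves*, 2nd ed., GTM 106 (2009), III.2.3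
(group law algorithm: chord through two points, third intersection), III.1 (`b₂, b₄, b₆`, the
`2`-division cubic, Ex. 3.7) [SilvermanAEC2009].  Mathlib: `WeierstrassCurve.Affine.addX/addY/slope`,
`twoTorsionPolynomial`.  Elementary algebra; no named fact.
-/

set_option autoImplicit false

namespace Literature.NumberTheory.EllipticCurves

namespace TwoTorsionChord

open WeierstrassCurve Polynomial

universe u

variable {F : Type u} [Field F] (W : WeierstrassCurve F)

/-- `η(x, negY x y) = −η(x, y)`: negation on the curve negates `η`.
[cite: SilvermanAEC2009, III.2.3 (negation formula)] -/
theorem eta_negY (x y : F) : 2 * W.toAffine.negY x y + W.a₁ * x + W.a₃ = -(2 * y + W.a₁ * x + W.a₃) := by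
  simp only [Affine.negY]
  ring

/-- **`η² = Ψ(x)` on the curve**: `(2y + a₁x + a₃)² = 4x³ + b₂x² + 2b₄x + b₆` for a point `(x, y)`
satisfying the Weierstrass equation. [cite: SilvermanAEC2009, III.1 and Ex. 3.7 (ψ₂² = 4x³ + b₂x² + 2b₄x + b₆)] -/
theorem eta_sq_eq {x y : F} (h : W.toAffine.Equation x y) :
    (2 * y + W.a₁ * x + W.a₃) ^ 2 = 4 * x ^ 3 + W.b₂ * x ^ 2 + 2 * W.b₄ * x + W.b₆ := by
  rw [Affine.equation_iff] at h
  simp only [b₂, b₄, b₆]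
  linear_combination 4 * h

/-- For a nonsingular affine point `T = (e, t)`: `η(T) = 0 ↔ T + T = O`.
[cite: SilvermanAEC2009, III.2.3 (d) (doubling; [2]P = O iff y = negY)] -/
theorem eta_eq_zero_iff_add_self_eq_zero [DecidableEq F] {e t : F} (h : W.toAffine.Nonsingular e t) :
    2 * t + W.a₁ * e + W.a₃ = 0 ↔ Affine.Point.some e t h + Affine.Point.some e t h = 0 := by
  have key : 2 * t + W.a₁ * e + W.a₃ = 0 ↔ t = W.toAffine.negY e t := by
    simp only [Affine.negY]
    constructor
    · intro h0; linear_combination h0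
    · intro h0; linear_combination h0
  rw [key]
  constructor
  · intro ht
    exact Affine.Point.add_self_of_Y_eq ht
  · intro hP
    by_contra ht
    rw [Affine.Point.add_self_of_Y_ne ht] at hP
    exact Affine.Point.some_ne_zero _ hP

/-- The derivative of the `2`-division cubic: `Ψ′(e) = 12e² + 2b₂e + 2b₄`.
[cite: SilvermanAEC2009, III.1 (the 2-division cubic 4x³ + b₂x² + 2b₄x + b₆)] -/
theorem derivative_twoTorsionPolynomial_eval (e : F) :
    (derivative W.twoTorsionPolynomial.toPoly).eval e = 12 * e ^ 2 + 2 * W.b₂ * e + 2 * W.b₄ := by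
  simp only [twoTorsionPolynomial, Cubic.toPoly, derivative_add, derivative_mul, derivative_C,
    derivative_X_pow, derivative_X, eval_add, eval_mul, eval_C, eval_pow, eval_X, zero_mul,
    zero_add, add_zero, Nat.cast_ofNat, mul_one]
  ring

section Chord

variable {W} [DecidableEq F]
variable {x₁ y₁ e t : F}

/-- The slope of the chord through `P = (x₁, y₁)` and `T = (e, t)` (`x₁ ≠ e`) clears to
`λ·(x₁ − e) = y₁ − t`. [cite: SilvermanAEC2009, III.2.3 (slope of the chord)] -/
theorem slope_mul_sub (hx : x₁ ≠ e) : W.toAffine.slope x₁ e y₁ t * (x₁ - e) = y₁ - t := by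
  rw [Affine.slope_of_X_ne hx, div_mul_cancel₀ _ (sub_ne_zero.mpr hx)]

/-- **(T1) Translation by a `2`-torsion point.**  For `P = (x₁, y₁)` on `W`, `T = (e, t)` on `W` with
`η(T) = 2t + a₁e + a₃ = 0` and `x₁ ≠ e`, the abscissa `x₃ = x(P + T)` satisfies
`4 (x₁ − e)(x₃ − e) = 12e² + 2b₂e + 2b₄ = Ψ′(e)` (the chord `T, P, −(P+T)` cuts out
`Ψ(x) − μ²(x−e)² = 4(x−e)(x−x₁)(x−x₃)`). [cite: SilvermanAEC2009, III.2.3 (group law algorithm; third intersection of a chord)] -/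
theorem four_mul_sub_mul_addX_sub (h₁ : W.toAffine.Equation x₁ y₁) (h₂ : W.toAffine.Equation e t)
    (ht : 2 * t + W.a₁ * e + W.a₃ = 0) (hx : x₁ ≠ e) :
    4 * ((x₁ - e) * (W.toAffine.addX x₁ e (W.toAffine.slope x₁ e y₁ t) - e))
      = 12 * e ^ 2 + 2 * W.b₂ * e + 2 * W.b₄ := by
  have hu : x₁ - e ≠ 0 := sub_ne_zero.mpr hx
  have hL := slope_mul_sub (W := W) (y₁ := y₁) (t := t) hx
  set L := W.toAffine.slope x₁ e y₁ t with hLdef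
  rw [Affine.equation_iff] at h₁ h₂
  apply mul_left_cancel₀ hu
  simp only [Affine.addX, b₂, b₄]
  linear_combination (4 * (L * (x₁ - e) + (y₁ - t)) + 4 * W.a₁ * (x₁ - e)) * hL + 4 * h₁ - 4 * h₂
    + (2 * (2 * t + W.a₁ * e + W.a₃) - 2 * (2 * y₁ + W.a₁ * x₁ + W.a₃)) * ht

/-- **(Y) `η` is linear along the chord and vanishes at `T`.**  With the notation of (T1) and
`y₃ = y(P + T)`: `η(x₃, y₃)·(x₁ − e) = −η(x₁, y₁)·(x₃ − e)`.
[cite: SilvermanAEC2009, III.2.3 (group law algorithm; the chord y = λx + ν)] -/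
theorem eta_add_mul_sub (ht : 2 * t + W.a₁ * e + W.a₃ = 0) (hx : x₁ ≠ e) :
    (2 * W.toAffine.addY x₁ e y₁ (W.toAffine.slope x₁ e y₁ t)
        + W.a₁ * W.toAffine.addX x₁ e (W.toAffine.slope x₁ e y₁ t) + W.a₃) * (x₁ - e)
      = -((2 * y₁ + W.a₁ * x₁ + W.a₃) * (W.toAffine.addX x₁ e (W.toAffine.slope x₁ e y₁ t) - e)) := by
  have hL := slope_mul_sub (W := W) (y₁ := y₁) (t := t) hx
  set L := W.toAffine.slope x₁ e y₁ t with hLdef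
  set X := W.toAffine.addX x₁ e L with hXdef
  simp only [Affine.addY, Affine.negY, Affine.negAddY]
  linear_combination (-2 * (X - x₁)) * hL + (X - x₁) * ht

/-- (T1) consequence: `x₁ ≠ e` forces `x₃ ≠ e` as soon as `Ψ′(e) ≠ 0` (separable `2`-division cubic,
e.g. `Δ ≠ 0` and `2 ≠ 0`). [cite: SilvermanAEC2009, III.2.3 (group law algorithm)] -/
theorem addX_ne_of_derivative_ne_zero (h₁ : W.toAffine.Equation x₁ y₁) (h₂ : W.toAffine.Equation e t)
    (ht : 2 * t + W.a₁ * e + W.a₃ = 0) (hx : x₁ ≠ e) (hD : 12 * e ^ 2 + 2 * W.b₂ * e + 2 * W.b₄ ≠ 0) :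
    W.toAffine.addX x₁ e (W.toAffine.slope x₁ e y₁ t) ≠ e := by
  intro h3
  have := four_mul_sub_mul_addX_sub h₁ h₂ ht hx
  rw [h3, sub_self, mul_zero, mul_zero] at this
  exact hD this.symm

/-- (T1)+(Y) consequence, the square behind Kummer isotropy: with `D := Ψ′(e)/4 = (x₁ − e)(x₃ − e)`,
`η(P+T)·(x₁ − e)² = −η(P)·D`, i.e. `4 η(P+T) (x₁ − e)² = −η(P) Ψ′(e)`.
[cite: SilvermanAEC2009, III.2.3 (group law algorithm)] -/
theorem four_mul_eta_add_mul_sub_sq (h₁ : W.toAffine.Equation x₁ y₁) (h₂ : W.toAffine.Equation e t)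
    (ht : 2 * t + W.a₁ * e + W.a₃ = 0) (hx : x₁ ≠ e) :
    4 * ((2 * W.toAffine.addY x₁ e y₁ (W.toAffine.slope x₁ e y₁ t)
        + W.a₁ * W.toAffine.addX x₁ e (W.toAffine.slope x₁ e y₁ t) + W.a₃) * (x₁ - e) ^ 2)
      = -((2 * y₁ + W.a₁ * x₁ + W.a₃) * (12 * e ^ 2 + 2 * W.b₂ * e + 2 * W.b₄)) := by
  have hY := eta_add_mul_sub (W := W) (y₁ := y₁) ht hx
  have hT := four_mul_sub_mul_addX_sub h₁ h₂ ht hx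
  set X := W.toAffine.addX x₁ e (W.toAffine.slope x₁ e y₁ t)
  set Y := W.toAffine.addY x₁ e y₁ (W.toAffine.slope x₁ e y₁ t)
  linear_combination 4 * (x₁ - e) * hY - (2 * y₁ + W.a₁ * x₁ + W.a₃) * hT

end Chord

end TwoTorsionChord

end Literature.NumberTheory.EllipticCurves
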